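import Summits.AtomisticToContinuum.HydrodynamicLimit.Theorems.CollisionIsometryCLTAdaptedWeightCLTTLReductionFold
import Summits.AtomisticToContinuum.HydrodynamicLimit.Theorems.CollisionIsometryCLTAdaptedWeightCLTTLReductionBounds
import Summits.AtomisticToContinuum.HydrodynamicLimit.Theorems.BoltzmannGreenKubo.Negative.JointMeasurability

/-!
# `stub_reduction` of the line `contact-source-duhamel`, helper file 4/6: measurability of the functionals
(crux `CollisionIsometryCLT.AdaptedWeightCLT`, stmt-AtomisticToContinuum-14868 = rev-12 TIME-LOCAL crux; `--supports`)

Continuation of `…TLReductionFold`. (1) For a FIXED number `m` of fold steps `pastF`, `xiF`, `xiChF` are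
measurable in `(y, w, u)`: case by case on the reflected pair (`measurableSet_stepPair_eq`,
`measurable_of_countable_cases`) `tStep` is measurable in `(y, T)` (hence `tTransport`), `src` in `(y, u)`,
`chaosCross` (ratio of polynomials, `0/0 = 0`) and `srcCh` in `(y, w, u)`; window sums are finite sums.
(2) ALONG A GOOD ORBIT `s ↦ Φ_s z` is measurable (`BoltzmannGreenKuboOrthMomentum.measurable_flowMod`), hence so
are the window start, the number of fold steps of the window (two window lengths,
`Alexander.measurable_collisionCount`) and, jointly in `(s, x)` for a continuous kernel, `wgt`, `ubar`, `blkFlow`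
and `DefectSq, PastSq, XiDevSq, XiCorr` (split the number of steps into its countably many values).
Registered anchor: `reduction_tTransport_succ`.
-/

namespace Summit.AtomisticToContinuum.HydrodynamicLimit.Theorems.ContactSourceDuhamel.TimeLocal.Reduction

open scoped BigOperators Topology Classical MeasureTheory ENNReal InnerProductSpace
open Filter Set MeasureTheory
open Literature.Analysis.FluidPDE
open Literature.MathematicalPhysics.KineticTheory (hsDiameter hsDiameter_le)

noncomputable section

variable {σ : ℝ} {N : ℕ} {r : ℕ}

/-! ## The incoherent transport -/

/-- One incoherent transport step as a function of the discrete data and the normal. -/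
def stepOf (o : Option (Fin (N + 1) × Fin (N + 1))) (n : V3) (T : Fin (N + 1) → Tens r) :
    Fin (N + 1) → Tens r :=
  match o with
  | none => T
  | some ij =>
    Function.update (Function.update T ij.1 (mapT (coprojM n) (T ij.1) + mapT (projM n) (T ij.2)))
      ij.2 (mapT (coprojM n) (T ij.2) + mapT (projM n) (T ij.1))

/-- `tStep` through `stepOf`. -/
theorem tStep_eq (y : Cfg N) (k : ℕ) (T : Fin (N + 1) → Tens r) :
    tStep r σ N y k T = stepOf (stepPair σ N y k) (stepNormal σ N y k) T := by
  unfold tStep stepOf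
  cases stepPair σ N y k <;> rfl

/-- `(n, T) ↦ stepOf o n T` is measurable. -/
theorem measurable_stepOf (o : Option (Fin (N + 1) × Fin (N + 1))) :
    Measurable fun p : V3 × (Fin (N + 1) → Tens r) => stepOf o p.1 p.2 := by
  cases o with
  | none => exact measurable_snd
  | some ij =>
    have hmix : ∀ i j : Fin (N + 1), Measurable fun p : V3 × (Fin (N + 1) → Tens r) =>
        mapT (coprojM p.1) (p.2 i) + mapT (projM p.1) (p.2 j) := fun i j =>
      (measurable_mapT (measurable_coprojM measurable_fst) ((measurable_pi_apply i).comp measurable_snd)).add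
        (measurable_mapT (measurable_projM measurable_fst) ((measurable_pi_apply j).comp measurable_snd))
    show Measurable fun p : V3 × (Fin (N + 1) → Tens r) =>
      Function.update (Function.update p.2 ij.1 (mapT (coprojM p.1) (p.2 ij.1) + mapT (projM p.1) (p.2 ij.2)))
        ij.2 (mapT (coprojM p.1) (p.2 ij.2) + mapT (projM p.1) (p.2 ij.1))
    exact measurable_update_of (measurable_update_of measurable_snd (hmix ij.1 ij.2)) (hmix ij.2 ij.1)

/-- `(y, T) ↦ tStep r σ N y k T` is measurable. -/
theorem measurable_tStep (hG : (Torus.geometry (Fin 3)).IsHardSphereRegular (hsDiameter σ N)) (k : ℕ) :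
    Measurable fun p : Cfg N × (Fin (N + 1) → Tens r) => tStep r σ N p.1 k p.2 := by
  simp only [tStep_eq]
  exact measurable_of_countable_cases (o := fun p : Cfg N × (Fin (N + 1) → Tens r) =>
      stepPair σ N p.1 k) (fun o => measurable_fst (measurableSet_stepPair_eq hG k o))
    (F := fun o p => stepOf o (stepNormal σ N p.1 k) p.2)
    fun o => ((measurable_stepOf o).comp
      (((measurable_stepNormal hG k).comp measurable_fst).prodMk measurable_snd) :)

/-- `tTransport m₁ (n + 1) = tStep (m₁ + n) ∘ tTransport m₁ n` (registered anchor of this helper file). -/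
theorem reduction_tTransport_succ : ∀ (r : ℕ) (σ : ℝ) (N : ℕ) (y : Cfg N) (m₁ n : ℕ)
    (T : Fin (N + 1) → Tens r),
    tTransport r σ N y m₁ (n + 1) T = tStep r σ N y (m₁ + n) (tTransport r σ N y m₁ n T) := by
  intro r σ N y m₁ n T
  rw [tTransport, tTransport, List.range'_1_concat, List.foldl_append]
  rfl

/-- `tTransport m₁ (n + 1) = tStep (m₁ + n) ∘ tTransport m₁ n`. -/
theorem tTransport_succ (y : Cfg N) (m₁ n : ℕ) (T : Fin (N + 1) → Tens r) :
    tTransport r σ N y m₁ (n + 1) T = tStep r σ N y (m₁ + n) (tTransport r σ N y m₁ n T) :=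
  reduction_tTransport_succ r σ N y m₁ n T

/-- `(y, T) ↦ tTransport r σ N y m₁ n T` is measurable. -/
theorem measurable_tTransport (hG : (Torus.geometry (Fin 3)).IsHardSphereRegular (hsDiameter σ N))
    (m₁ n : ℕ) : Measurable fun p : Cfg N × (Fin (N + 1) → Tens r) => tTransport r σ N p.1 m₁ n p.2 := by
  induction n with
  | zero => exact measurable_snd
  | succ n ih =>
    simp only [tTransport_succ]
    exact ((measurable_tStep hG (m₁ + n)).comp (measurable_fst.prodMk ih) :)

/-! ## Sources and chaos values -/

/-- The contact source as a function of the discrete data, the normal, the fold velocities, the shift. -/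
def srcOf (o : Option (Fin (N + 1) × Fin (N + 1))) (n : V3) (V : Vel N) (u : V3) :
    Fin (N + 1) → Tens r :=
  match o with
  | none => 0
  | some ij =>
    Function.update (Function.update 0 ij.1
        (crossT r (coprojV n (V ij.1 - u)) (projV n (V ij.2 - u))))
      ij.2 (crossT r (coprojV n (V ij.2 - u)) (projV n (V ij.1 - u)))

/-- `src` through `srcOf`. -/
theorem src_eq (y : Cfg N) (u : V3) (l : ℕ) :
    src r σ N y u l = srcOf (stepPair σ N y l) (stepNormal σ N y l) (velAfter σ N y l) u := by
  unfold src srcOf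
  cases stepPair σ N y l <;> rfl

/-- `(n, V, u) ↦ srcOf o n V u` is measurable. -/
theorem measurable_srcOf (o : Option (Fin (N + 1) × Fin (N + 1))) :
    Measurable fun p : V3 × (Vel N × V3) => srcOf (r := r) o p.1 p.2.1 p.2.2 := by
  cases o with
  | none => exact measurable_const
  | some ij =>
    have hV : ∀ i : Fin (N + 1), Measurable fun p : V3 × (Vel N × V3) => p.2.1 i - p.2.2 := fun i =>
      ((measurable_pi_apply i).comp measurable_snd.fst).sub measurable_snd.snd
    have hX : ∀ i j : Fin (N + 1), Measurable fun p : V3 × (Vel N × V3) =>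
        crossT r (coprojV p.1 (p.2.1 i - p.2.2)) (projV p.1 (p.2.1 j - p.2.2)) := fun i j =>
      measurable_crossT (measurable_coprojV measurable_fst (hV i)) (measurable_projV measurable_fst (hV j))
    show Measurable fun p : V3 × (Vel N × V3) =>
      Function.update (Function.update (0 : Fin (N + 1) → Tens r) ij.1
        (crossT r (coprojV p.1 (p.2.1 ij.1 - p.2.2)) (projV p.1 (p.2.1 ij.2 - p.2.2))))
        ij.2 (crossT r (coprojV p.1 (p.2.1 ij.2 - p.2.2)) (projV p.1 (p.2.1 ij.1 - p.2.2)))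
    exact measurable_update_of (measurable_update_of measurable_const (hX ij.1 ij.2)) (hX ij.2 ij.1)

/-- `(y, u) ↦ src r σ N y u l` is measurable. -/
theorem measurable_src (hG : (Torus.geometry (Fin 3)).IsHardSphereRegular (hsDiameter σ N)) (l : ℕ) :
    Measurable fun p : Cfg N × V3 => src r σ N p.1 p.2 l := by
  have hin : Measurable fun p : Cfg N × V3 => (stepNormal σ N p.1 l, (velAfter σ N p.1 l, p.2)) :=
    ((measurable_stepNormal hG l).comp measurable_fst).prodMk
      (((measurable_velAfter hG l).comp measurable_fst).prodMk measurable_snd)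
  have hF : ∀ o : Option (Fin (N + 1) × Fin (N + 1)), Measurable fun p : Cfg N × V3 =>
      srcOf (r := r) o (stepNormal σ N p.1 l) (velAfter σ N p.1 l) p.2 := fun o =>
    ((measurable_srcOf o).comp hin :)
  simp only [src_eq]
  exact measurable_of_countable_cases (o := fun p : Cfg N × V3 => stepPair σ N p.1 l)
    (fun o => measurable_fst (measurableSet_stepPair_eq hG l o))
    (F := fun o p => srcOf o (stepNormal σ N p.1 l) (velAfter σ N p.1 l) p.2) hF

/-- `(w, W, u, n) ↦ chaosCross r N w W u n` is measurable (a ratio of polynomials; `0/0 = 0`). -/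
theorem measurable_chaosCross :
    Measurable fun p : (Fin (N + 1) → ℝ) × (Vel N × (V3 × V3)) => chaosCross r N p.1 p.2.1 p.2.2.1 p.2.2.2 := by
  have hw : ∀ k : Fin (N + 1), Measurable fun p : (Fin (N + 1) → ℝ) × (Vel N × (V3 × V3)) => p.1 k :=
    fun k => (measurable_pi_apply k).comp measurable_fst
  have hW : ∀ k : Fin (N + 1), Measurable fun p : (Fin (N + 1) → ℝ) × (Vel N × (V3 × V3)) => p.2.1 k :=
    fun k => (measurable_pi_apply k).comp measurable_snd.fst
  have hu : Measurable fun p : (Fin (N + 1) → ℝ) × (Vel N × (V3 × V3)) => p.2.2.1 := measurable_snd.snd.fst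
  have hn : Measurable fun p : (Fin (N + 1) → ℝ) × (Vel N × (V3 × V3)) => p.2.2.2 := measurable_snd.snd.snd
  have hflux : ∀ k k' : Fin (N + 1), Measurable fun p : (Fin (N + 1) → ℝ) × (Vel N × (V3 × V3)) =>
      p.1 k * p.1 k' * |⟪p.2.1 k - p.2.1 k', p.2.2.2⟫_ℝ| := fun k k' =>
    ((hw k).mul (hw k')).mul (continuous_abs.measurable.comp (((hW k).sub (hW k')).inner hn))
  refine measurable_pi_lambda _ fun idx => ?_
  refine (Finset.measurable_sum _ fun k _ => Finset.measurable_sum _ fun k' _ => ?_).div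
    (Finset.measurable_sum _ fun k _ => Finset.measurable_sum _ fun k' _ => hflux k k')
  exact (hflux k k').mul ((measurable_pi_apply idx).comp
    (measurable_crossT (measurable_coprojV hn ((hW k).sub hu)) (measurable_projV hn ((hW k').sub hu))))

/-- The chaos-value source as a function of the discrete data and the chaos tensor. -/
def srcChOf (o : Option (Fin (N + 1) × Fin (N + 1))) (X : Tens r) : Fin (N + 1) → Tens r :=
  match o with
  | none => 0
  | some ij => Function.update (Function.update 0 ij.1 X) ij.2 X

/-- `srcCh` through `srcChOf`. -/
theorem srcCh_eq (y : Cfg N) (w : Fin (N + 1) → ℝ) (u : V3) (l : ℕ) :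
    srcCh r σ N y w u l =
      srcChOf (stepPair σ N y l) (chaosCross r N w (velAfter σ N y l) u (stepNormal σ N y l)) := by
  unfold srcCh srcChOf
  cases stepPair σ N y l <;> rfl

/-- `X ↦ srcChOf o X` is measurable. -/
theorem measurable_srcChOf (o : Option (Fin (N + 1) × Fin (N + 1))) :
    Measurable fun X : Tens r => srcChOf (N := N) o X := by
  cases o with
  | none => exact measurable_const
  | some ij =>
    show Measurable fun X : Tens r =>
      Function.update (Function.update (0 : Fin (N + 1) → Tens r) ij.1 X) ij.2 X
    exact measurable_update_of (measurable_update_of measurable_const measurable_id) measurable_id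

/-- `(y, w, u) ↦ srcCh r σ N y w u l` is measurable. -/
theorem measurable_srcCh (hG : (Torus.geometry (Fin 3)).IsHardSphereRegular (hsDiameter σ N)) (l : ℕ) :
    Measurable fun p : Cfg N × ((Fin (N + 1) → ℝ) × V3) => srcCh r σ N p.1 p.2.1 p.2.2 l := by
  have hin : Measurable fun p : Cfg N × ((Fin (N + 1) → ℝ) × V3) =>
      (p.2.1, (velAfter σ N p.1 l, (p.2.2, stepNormal σ N p.1 l))) :=
    measurable_snd.fst.prodMk (((measurable_velAfter hG l).comp measurable_fst).prodMk
      (measurable_snd.snd.prodMk ((measurable_stepNormal hG l).comp measurable_fst)))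
  have hX : Measurable fun p : Cfg N × ((Fin (N + 1) → ℝ) × V3) =>
      chaosCross r N p.2.1 (velAfter σ N p.1 l) p.2.2 (stepNormal σ N p.1 l) :=
    ((measurable_chaosCross (r := r)).comp hin :)
  have hF : ∀ o : Option (Fin (N + 1) × Fin (N + 1)),
      Measurable fun p : Cfg N × ((Fin (N + 1) → ℝ) × V3) =>
        srcChOf (N := N) o (chaosCross r N p.2.1 (velAfter σ N p.1 l) p.2.2 (stepNormal σ N p.1 l)) :=
    fun o => ((measurable_srcChOf o).comp hX :)
  simp only [srcCh_eq]
  exact measurable_of_countable_cases (o := fun p : Cfg N × ((Fin (N + 1) → ℝ) × V3) =>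
      stepPair σ N p.1 l) (fun o => measurable_fst (measurableSet_stepPair_eq hG l o))
    (F := fun o p => srcChOf o (chaosCross r N p.2.1 (velAfter σ N p.1 l) p.2.2 (stepNormal σ N p.1 l)))
    hF

/-! ## The window functionals for a fixed number of fold steps -/

/-- `(y, w, u) ↦ pastF r σ N y m w u C` is measurable. -/
theorem measurable_pastF (hG : (Torus.geometry (Fin 3)).IsHardSphereRegular (hsDiameter σ N)) (m : ℕ)
    (C : Tens r) :
    Measurable fun p : Cfg N × ((Fin (N + 1) → ℝ) × V3) => pastF r σ N p.1 m p.2.1 p.2.2 C := by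
  have hT0 : Measurable fun p : Cfg N × ((Fin (N + 1) → ℝ) × V3) =>
      (fun k => tpow r ((p.1 k).2 - p.2.2) : Fin (N + 1) → Tens r) :=
    measurable_pi_lambda (fun p : Cfg N × ((Fin (N + 1) → ℝ) × V3) =>
      (fun k => tpow r ((p.1 k).2 - p.2.2) : Fin (N + 1) → Tens r)) fun k => measurable_tpow
        (((Geometry.IsMeasurable.measurable_vel k).comp measurable_fst).sub measurable_snd.snd)
  have hT : Measurable fun p : Cfg N × ((Fin (N + 1) → ℝ) × V3) =>
      tTransport r σ N p.1 0 m (fun k => tpow r ((p.1 k).2 - p.2.2)) :=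
    ((measurable_tTransport (r := r) hG 0 m).comp (measurable_fst.prodMk hT0) :)
  refine (Finset.measurable_sum _ fun i _ => ?_).const_mul _
  exact ((measurable_pi_apply i).comp measurable_snd.fst).mul
    (measurable_pairT C ((measurable_pi_apply i).comp hT))

/-- `(y, w, u) ↦ xiF r σ N y m w u C` is measurable. -/
theorem measurable_xiF (hG : (Torus.geometry (Fin 3)).IsHardSphereRegular (hsDiameter σ N)) (m : ℕ)
    (C : Tens r) :
    Measurable fun p : Cfg N × ((Fin (N + 1) → ℝ) × V3) => xiF r σ N p.1 m p.2.1 p.2.2 C := by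
  refine (Finset.measurable_sum _ fun l _ => Finset.measurable_sum _ fun i _ => ?_).const_mul _
  have hS : Measurable fun p : Cfg N × ((Fin (N + 1) → ℝ) × V3) => src r σ N p.1 p.2.2 l :=
    ((measurable_src (r := r) hG l).comp (measurable_fst.prodMk measurable_snd.snd) :)
  have hT : Measurable fun p : Cfg N × ((Fin (N + 1) → ℝ) × V3) =>
      tTransport r σ N p.1 (l + 1) (m - (l + 1)) (src r σ N p.1 p.2.2 l) :=
    ((measurable_tTransport (r := r) hG (l + 1) (m - (l + 1))).comp (measurable_fst.prodMk hS) :)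
  exact ((measurable_pi_apply i).comp measurable_snd.fst).mul
    (measurable_pairT C ((measurable_pi_apply i).comp hT))

/-- `(y, w, u) ↦ xiChF r σ N y m w u C` is measurable. -/
theorem measurable_xiChF (hG : (Torus.geometry (Fin 3)).IsHardSphereRegular (hsDiameter σ N)) (m : ℕ)
    (C : Tens r) :
    Measurable fun p : Cfg N × ((Fin (N + 1) → ℝ) × V3) => xiChF r σ N p.1 m p.2.1 p.2.2 C := by
  refine (Finset.measurable_sum _ fun l _ => Finset.measurable_sum _ fun i _ => ?_).const_mul _
  have hT : Measurable fun p : Cfg N × ((Fin (N + 1) → ℝ) × V3) =>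
      tTransport r σ N p.1 (l + 1) (m - (l + 1)) (srcCh r σ N p.1 p.2.1 p.2.2 l) :=
    ((measurable_tTransport (r := r) hG (l + 1) (m - (l + 1))).comp
      (measurable_fst.prodMk (measurable_srcCh hG l)) :)
  exact ((measurable_pi_apply i).comp measurable_snd.fst).mul
    (measurable_pairT C ((measurable_pi_apply i).comp hT))

/-! ## Along a good orbit: measurability in time and in `(s, x)` -/

/-- A good orbit is a measurable function of time. -/
theorem measurable_flow_of_mem_good (Φ : Flow σ N) {z : Cfg N} (hz : z ∈ Φ.good) :
    Measurable fun s : ℝ => Φ.flow s z := by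
  have h : (fun s : ℝ => Φ.flow s z) = fun s => BoltzmannGreenKuboOrthMomentum.flowMod Φ (s, z) :=
    funext fun s => (BoltzmannGreenKuboOrthMomentum.flowMod_of_mem Φ hz).symm
  rw [h]
  exact (BoltzmannGreenKuboOrthMomentum.measurable_flowMod Φ).comp (measurable_id.prodMk measurable_const)

/-- The window length is a measurable function of time (two values). -/
theorem measurable_winLen (N : ℕ) : Measurable (winLen N) := by
  unfold winLen
  exact Measurable.ite measurableSet_Iio measurable_const measurable_const

/-- The window start is a measurable function of time. -/
theorem measurable_winStart (Φ : Flow σ N) {z : Cfg N} (hz : z ∈ Φ.good) :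
    Measurable fun s => winStart σ N Φ s z := by
  unfold winStart
  exact (measurable_flow_of_mem_good Φ hz).comp (measurable_id.sub (measurable_winLen N))

/-- The number of fold steps of the window is a measurable function of time. -/
theorem measurable_steps_win (hG : (Torus.geometry (Fin 3)).IsHardSphereRegular (hsDiameter σ N))
    (Φ : Flow σ N) {z : Cfg N} (hz : z ∈ Φ.good) :
    Measurable fun s => steps σ N (winStart σ N Φ s z) (winLen N s) := by
  have hfl := measurable_flow_of_mem_good Φ hz
  have h : (fun s => steps σ N (winStart σ N Φ s z) (winLen N s)) = fun s =>
      if s < Δℓ N then steps σ N (Φ.flow (s - 0) z) 0 else steps σ N (Φ.flow (s - Δℓ N) z) (Δℓ N) := by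
    funext s
    unfold winStart winLen
    split_ifs <;> rfl
  rw [h]
  refine Measurable.ite measurableSet_Iio ?_ ?_
  · exact ((Alexander.measurable_collisionCount hG gm 0).comp (hfl.comp (measurable_id.sub_const _)) :)
  · exact ((Alexander.measurable_collisionCount hG gm (Δℓ N)).comp
      (hfl.comp (measurable_id.sub_const _)) :)

section Kernel

variable {Φ : Flow σ N} {z : Cfg N} {φ : ℕ → T3 → ℝ}

/-- The weights are jointly measurable in `(s, x)` (continuous kernel). -/
theorem measurable_wgt (hz : z ∈ Φ.good) (hφc : Continuous (φ N)) :
    Measurable fun p : ℝ × T3 => wgt σ N Φ φ p.1 z p.2 := by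
  have hfl := measurable_flow_of_mem_good Φ hz
  unfold wgt
  refine measurable_pi_lambda (fun p : ℝ × T3 => fun i => φ N ((Φ.flow p.1 z i).1 - p.2)) fun i => ?_
  exact hφc.measurable.comp
    (((Geometry.IsMeasurable.measurable_pos i).comp (hfl.comp measurable_fst)).sub measurable_snd)

/-- The block velocity is jointly measurable in `(s, x)`. -/
theorem measurable_ubar (hz : z ∈ Φ.good) (hφc : Continuous (φ N)) :
    Measurable fun p : ℝ × T3 => ubar σ N Φ φ p.1 z p.2 := by
  have hfl := measurable_flow_of_mem_good Φ hz
  have hφi : ∀ i, Measurable fun p : ℝ × T3 => φ N ((Φ.flow p.1 z i).1 - p.2) := fun i =>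
    hφc.measurable.comp
      (((Geometry.IsMeasurable.measurable_pos i).comp (hfl.comp measurable_fst)).sub measurable_snd)
  have hv : ∀ i, Measurable fun p : ℝ × T3 => (Φ.flow p.1 z i).2 := fun i =>
    (Geometry.IsMeasurable.measurable_vel i).comp (hfl.comp measurable_fst)
  simp only [ubar_eq']
  exact ((Finset.measurable_sum _ fun i _ => hφi i).const_mul _).inv.fun_smul
    (measurable_const.fun_smul (Finset.measurable_sum _ fun i _ => (hφi i).fun_smul (hv i)))

/-- The flow-side block moments are jointly measurable in `(s, x)`. -/
theorem measurable_blkFlow (hz : z ∈ Φ.good) (hφc : Continuous (φ N)) (C : Tens r) :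
    Measurable fun p : ℝ × T3 => blkFlow r σ N Φ φ p.1 z p.2 C := by
  have hfl := measurable_flow_of_mem_good Φ hz
  have hw : ∀ i, Measurable fun p : ℝ × T3 => wgt σ N Φ φ p.1 z p.2 i := fun i =>
    ((measurable_pi_apply i).comp (measurable_wgt hz hφc) :)
  have hv : ∀ i, Measurable fun p : ℝ × T3 => (Φ.flow p.1 z i).2 := fun i =>
    (Geometry.IsMeasurable.measurable_vel i).comp (hfl.comp measurable_fst)
  unfold blkFlow
  refine (Finset.measurable_sum _ fun i _ => ?_).const_mul _
  exact (hw i).mul (measurable_pairT C (measurable_tpow ((hv i).sub (measurable_ubar hz hφc))))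

/-- `DefectSq` is jointly measurable in `(s, x)`. -/
theorem measurable_defectSq (hz : z ∈ Φ.good) (hφc : Continuous (φ N)) :
    Measurable fun p : ℝ × T3 => DefectSq σ N Φ φ p.1 z p.2 := by
  unfold DefectSq
  exact (Finset.measurable_sum _ fun j _ => Finset.measurable_sum _ fun k _ =>
    (measurable_blkFlow hz hφc (C2 j k)).pow_const 2).add
    (Finset.measurable_sum _ fun a _ => (measurable_blkFlow hz hφc (C3 a)).pow_const 2)

/-- The window data `(y, w, u)` are jointly measurable in `(s, x)`. -/
theorem measurable_winData (hz : z ∈ Φ.good) (hφc : Continuous (φ N)) :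
    Measurable fun p : ℝ × T3 =>
      (winStart σ N Φ p.1 z, (wgt σ N Φ φ p.1 z p.2, ubar σ N Φ φ p.1 z p.2)) :=
  ((measurable_winStart Φ hz).comp measurable_fst).prodMk
    ((measurable_wgt hz hφc).prodMk (measurable_ubar hz hφc))

/-- A window functional measurable in `(y, w, u)` for each `m` is measurable in `(s, x)` along a good orbit. -/
theorem measurable_winFun (hG : (Torus.geometry (Fin 3)).IsHardSphereRegular (hsDiameter σ N))
    (hz : z ∈ Φ.good) (hφc : Continuous (φ N)) (F : Cfg N → ℕ → (Fin (N + 1) → ℝ) → V3 → ℝ)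
    (hF : ∀ m, Measurable fun p : Cfg N × ((Fin (N + 1) → ℝ) × V3) => F p.1 m p.2.1 p.2.2) :
    Measurable fun p : ℝ × T3 => F (winStart σ N Φ p.1 z)
      (steps σ N (winStart σ N Φ p.1 z) (winLen N p.1)) (wgt σ N Φ φ p.1 z p.2) (ubar σ N Φ φ p.1 z p.2) := by
  have hF' : ∀ m : ℕ, Measurable fun p : ℝ × T3 =>
      F (winStart σ N Φ p.1 z) m (wgt σ N Φ φ p.1 z p.2) (ubar σ N Φ φ p.1 z p.2) := fun m =>
    ((hF m).comp (measurable_winData hz hφc) :)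
  exact measurable_of_countable_cases
    (o := fun p : ℝ × T3 => steps σ N (winStart σ N Φ p.1 z) (winLen N p.1))
    (fun m => measurable_fst ((measurable_steps_win hG Φ hz) (measurableSet_singleton m)))
    (F := fun m p => F (winStart σ N Φ p.1 z) m (wgt σ N Φ φ p.1 z p.2) (ubar σ N Φ φ p.1 z p.2)) hF'

/-- `PastSq` is jointly measurable in `(s, x)`. -/
theorem measurable_pastSq (hG : (Torus.geometry (Fin 3)).IsHardSphereRegular (hsDiameter σ N))
    (hz : z ∈ Φ.good) (hφc : Continuous (φ N)) :
    Measurable fun p : ℝ × T3 => PastSq σ N Φ φ p.1 z p.2 := by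
  have hP : ∀ (r : ℕ) (C : Tens r), Measurable fun p : ℝ × T3 => pastF r σ N (winStart σ N Φ p.1 z)
      (steps σ N (winStart σ N Φ p.1 z) (winLen N p.1)) (wgt σ N Φ φ p.1 z p.2) (ubar σ N Φ φ p.1 z p.2) C :=
    fun r C => measurable_winFun hG hz hφc (fun y m w u => pastF r σ N y m w u C) fun m => measurable_pastF hG m C
  unfold PastSq
  exact (Finset.measurable_sum _ fun j _ => Finset.measurable_sum _ fun k _ => (hP 2 (C2 j k)).pow_const 2).add
    (Finset.measurable_sum _ fun a _ => (hP 3 (C3 a)).pow_const 2)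

/-- Ξ and Ξ^ch along a good orbit are jointly measurable in `(s, x)`. -/
theorem measurable_xi_flow (hG : (Torus.geometry (Fin 3)).IsHardSphereRegular (hsDiameter σ N))
    (hz : z ∈ Φ.good) (hφc : Continuous (φ N)) (C : Tens r) :
    (Measurable fun p : ℝ × T3 => xiF r σ N (winStart σ N Φ p.1 z)
      (steps σ N (winStart σ N Φ p.1 z) (winLen N p.1)) (wgt σ N Φ φ p.1 z p.2) (ubar σ N Φ φ p.1 z p.2) C) ∧
    Measurable fun p : ℝ × T3 => xiChF r σ N (winStart σ N Φ p.1 z)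
      (steps σ N (winStart σ N Φ p.1 z) (winLen N p.1)) (wgt σ N Φ φ p.1 z p.2) (ubar σ N Φ φ p.1 z p.2) C :=
  ⟨measurable_winFun hG hz hφc (fun y m w u => xiF r σ N y m w u C) fun m => measurable_xiF hG m C,
    measurable_winFun hG hz hφc (fun y m w u => xiChF r σ N y m w u C) fun m => measurable_xiChF hG m C⟩

/-- `XiDevSq` is jointly measurable in `(s, x)`. -/
theorem measurable_xiDevSq (hG : (Torus.geometry (Fin 3)).IsHardSphereRegular (hsDiameter σ N))
    (hz : z ∈ Φ.good) (hφc : Continuous (φ N)) :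
    Measurable fun p : ℝ × T3 => XiDevSq σ N Φ φ p.1 z p.2 := by
  unfold XiDevSq
  exact (Finset.measurable_sum _ fun j _ => Finset.measurable_sum _ fun k _ =>
    ((measurable_xi_flow hG hz hφc (C2 j k)).1.sub (measurable_xi_flow hG hz hφc (C2 j k)).2).pow_const 2).add
    (Finset.measurable_sum _ fun a _ =>
      ((measurable_xi_flow hG hz hφc (C3 a)).1.sub (measurable_xi_flow hG hz hφc (C3 a)).2).pow_const 2)

/-- `XiCorr` is jointly measurable in `(s, x)`. -/
theorem measurable_xiCorr (hG : (Torus.geometry (Fin 3)).IsHardSphereRegular (hsDiameter σ N))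
    (hz : z ∈ Φ.good) (hφc : Continuous (φ N)) :
    Measurable fun p : ℝ × T3 => XiCorr σ N Φ φ p.1 z p.2 := by
  unfold XiCorr
  exact (Finset.measurable_sum _ fun j _ => Finset.measurable_sum _ fun k _ =>
    (measurable_blkFlow hz hφc (C2 j k)).mul (measurable_xi_flow hG hz hφc (C2 j k)).2).add
    (Finset.measurable_sum _ fun a _ =>
      (measurable_blkFlow hz hφc (C3 a)).mul (measurable_xi_flow hG hz hφc (C3 a)).2)

end Kernel

end

end Summit.AtomisticToContinuum.HydrodynamicLimit.Theorems.ContactSourceDuhamel.TimeLocal.Reduction
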